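import Summits.QuantumFields.QCD.Theorems.WilsonMobilityGapMobilityGapSketchFreeReduction
import Literature.Barriers.QuantumFields.WilsonDeterminantMassSplitting

/-!
# Crux `MobilityGap` (stmt-QuantumFields-9150) — line `Sketch`, reshape 4: the two-flavour sign clause is a WINDOW law

Lead seat prover-line-stmt-QuantumFields-9150-c4-0 (cycle 5 of the line), helper file `--supports stmt-QuantumFields-9150`.

Clause (iv) of the crux (sign coherence `½ ≤ |∫ det D dμ_W| / ∫ |det D| dμ_W` at the scheme's own volume) is glued
to the extinction stub of the line through the landed `PositivityDeficitLeDefects`: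
`(1 − ⟨sign⟩₊)/2 ≤ E₊[Σ_f #{real eigenvalues of D_W(U,0,1) below −t_f}]` — every deep real-mode crosser of every
flavour is charged.  For TWO flavours this is wasteful.  The Wilson determinant is a real polynomial in the bare
mass (`γ₅`-hermiticity, `D_W(t) = D_W(0) + t`), so a NEGATIVE two-flavour weight `det D_W(t₀)·det D_W(t₁) < 0`
forces a zero strictly between the two bare masses (intermediate value theorem — the mass-splitting lemma
`exists_zero_between_of_det_mul_neg` of the barrier `Literature.Barriers.QuantumFields.WilsonDeterminantMassSplitting`,
met head-on here), i.e. a real eigenvalue of `D_W(U,0,1)` in the open SPREAD WINDOW `(−max t, −min t)`, whose width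
along the line is `≤ a_k M / Z_m(k)`.  Hence (§3) `(1 − ⟨sign⟩₊)/2 ≤ E₊[#{real eigenvalues in the window}]` for
`N_f = 2`, and (§4–§5) the `N_f = 2` half of clause (iv) follows from a WINDOW LAW — the phase-quenched expected
number of real modes in the spread window is `≤ 1/4` at the scheme's volume (a Wegner-type statement, void on the
degenerate diagonal `t₀ = t₁`) — instead of the extinction of ALL deep crossers below `|m_crit(k)|` (a Lifshitz-tail
statement), which the line keeps for `N_f = 3` only.

§1 measurability of the window count (two-sided version of the landed `measurable_countP_charpoly_roots_real_lt`) ·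
§2 the pointwise bound `Π|det| − Re Π det ≤ 2·#window·Π|det|` for two flavours · §3 the integrated deficit bound ·
§4 sign coherence from a small window count · §5 the glue `signAt_of_windowAt` along a free datum and the composition
`MobilityGap_of_freeLaws_window` used by the reshaped skeleton (stubs `stub_lightFree`, `stub_lowerAt`,
`stub_windowAt` (`N_f = 2`), `stub_extinctAt` (`N_f = 3`)).
-/

noncomputable section

namespace Summit.QuantumFields.QCD.Theorems.MobilityGapSketch

open scoped BigOperators Topology
open MeasureTheory Filter Set
open Literature.MathematicalPhysics.QuantumFieldTheory Literature.MathematicalPhysics.QuantumLattice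
  Literature.Probability.LatticeModels

/-! ### §1 Measurability of the window count of a continuous matrix family -/

section Family

variable {X : Type*} [TopologicalSpace X] {n : Type*} [Fintype n] [DecidableEq n]

/-- The count of roots in an OPEN real window is reached by closed sub-windows: for every matrix `B` there is `j`
with `#{roots : Im = 0, lo < Re < hi} ≤ #{roots : Im = 0, lo + 1/(j+1) ≤ Re ≤ hi − 1/(j+1)}` (finitely many roots,
each at a positive distance from the two ends). [folklore] -/
theorem exists_countP_window_le_countP_closed (B : Matrix n n ℂ) (lo hi : ℝ) :
    ∃ j : ℕ, B.charpoly.roots.countP (fun z => z.im = 0 ∧ lo < z.re ∧ z.re < hi) ≤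
      B.charpoly.roots.countP
        (fun z => z.im = 0 ∧ lo + 1 / ((j : ℝ) + 1) ≤ z.re ∧ z.re ≤ hi - 1 / ((j : ℝ) + 1)) := by
  classical
  have hmargin : ∀ z : ℂ, lo < z.re ∧ z.re < hi →
      ∃ j : ℕ, 1 / ((j : ℝ) + 1) < min (z.re - lo) (hi - z.re) := fun z hz =>
    exists_nat_one_div_lt (lt_min (sub_pos.2 hz.1) (sub_pos.2 hz.2))
  choose! jz hjz using hmargin
  refine ⟨(B.charpoly.roots.toFinset.filter fun z => lo < z.re ∧ z.re < hi).sup jz, ?_⟩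
  set J := (B.charpoly.roots.toFinset.filter fun z => lo < z.re ∧ z.re < hi).sup jz with hJ
  have key : ∀ z ∈ B.charpoly.roots, lo < z.re ∧ z.re < hi →
      lo + 1 / ((J : ℝ) + 1) ≤ z.re ∧ z.re ≤ hi - 1 / ((J : ℝ) + 1) := by
    intro z hzmem hz
    have hzJ : jz z ≤ J := Finset.le_sup (f := jz)
      (Finset.mem_filter.2 ⟨Multiset.mem_toFinset.2 hzmem, hz⟩)
    have h1 : 1 / ((J : ℝ) + 1) ≤ 1 / ((jz z : ℝ) + 1) :=
      one_div_le_one_div_of_le (by positivity) (by exact_mod_cast Nat.succ_le_succ hzJ)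
    have h2 := hjz z hz
    have h3 := min_le_left (z.re - lo) (hi - z.re)
    have h4 := min_le_right (z.re - lo) (hi - z.re)
    constructor <;> linarith
  rw [Multiset.countP_eq_card_filter, Multiset.countP_eq_card_filter]
  refine Multiset.card_le_card ?_
  rw [Multiset.filter_congr (p := fun z => z.im = 0 ∧ lo < z.re ∧ z.re < hi)
    (q := fun z => (z.im = 0 ∧ lo < z.re ∧ z.re < hi) ∧
      (z.im = 0 ∧ lo + 1 / ((J : ℝ) + 1) ≤ z.re ∧ z.re ≤ hi - 1 / ((J : ℝ) + 1))) fun z hz =>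
      ⟨fun h => ⟨h, h.1, key z hz h.2⟩, fun h => h.1⟩]
  exact Multiset.monotone_filter_right _ fun z hz => hz.2

/-- **Measurability of the window count.**  For a continuous matrix family `A` on a sequential space with a
Borel-compatible σ-algebra, the number (with algebraic multiplicity) of REAL eigenvalues of `A x` in an open window
`(lo, hi)` — `Multiset.countP (fun z => z.im = 0 ∧ lo < z.re ∧ z.re < hi) (charpoly (A x)).roots` — is a measurable
function of `x`: its superlevel sets are countable unions over `j` of the closed superlevel sets of the counts over
the closed windows `{Im z = 0, lo + 1/(j+1) ≤ Re z ≤ hi − 1/(j+1)}` (landed `isClosed_le_countP_charpoly_roots`).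
[folklore] -/
theorem measurable_countP_charpoly_roots_window [SequentialSpace X] [MeasurableSpace X]
    [OpensMeasurableSpace X] {A : X → Matrix n n ℂ} (hA : Continuous A) (lo hi : ℝ) :
    Measurable fun x => (A x).charpoly.roots.countP fun z => z.im = 0 ∧ lo < z.re ∧ z.re < hi := by
  classical
  refine PositivityDeficitLeDefects.measurable_of_measurableSet_le fun k => ?_
  have hset : {x | k ≤ (A x).charpoly.roots.countP fun z => z.im = 0 ∧ lo < z.re ∧ z.re < hi} =
      ⋃ j : ℕ, {x | k ≤ (A x).charpoly.roots.countP
        fun z => z ∈ {w : ℂ | w.im = 0 ∧ lo + 1 / ((j : ℝ) + 1) ≤ w.re ∧ w.re ≤ hi - 1 / ((j : ℝ) + 1)}} := by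
    ext x
    simp only [Set.mem_setOf_eq, Set.mem_iUnion]
    constructor
    · intro hk
      obtain ⟨j, hj⟩ := exists_countP_window_le_countP_closed (A x) lo hi
      exact ⟨j, hk.trans hj⟩
    · rintro ⟨j, hj⟩
      refine hj.trans ?_
      rw [Multiset.countP_eq_card_filter, Multiset.countP_eq_card_filter]
      refine Multiset.card_le_card (Multiset.monotone_filter_right _ fun z hz => ⟨hz.1, ?_, ?_⟩)
      · have : 0 < 1 / ((j : ℝ) + 1) := by positivity
        linarith [hz.2.1]
      · have : 0 < 1 / ((j : ℝ) + 1) := by positivity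
        linarith [hz.2.2]
  rw [hset]
  refine MeasurableSet.iUnion fun j => IsClosed.measurableSet ?_
  have hFj : IsClosed {w : ℂ | w.im = 0 ∧ lo + 1 / ((j : ℝ) + 1) ≤ w.re ∧ w.re ≤ hi - 1 / ((j : ℝ) + 1)} :=
    (isClosed_eq Complex.continuous_im continuous_const).inter
      ((isClosed_le continuous_const Complex.continuous_re).inter
        (isClosed_le Complex.continuous_re continuous_const))
  exact PositivityDeficitLeDefects.isClosed_le_countP_charpoly_roots hA hFj k

end Family

/-! ### §2 Two flavours: a negative weight forces a real mode in the spread window -/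

variable {N : ℕ} [NeZero N]

/-- **Sign ⇒ window mode, configurationwise (two flavours).**  If the two-flavour Wilson weight at bare masses
`t₀, t₁` is negative, `Re (det D_W(U,t₀,1) · det D_W(U,t₁,1)) < 0`, then `D_W(U,0,1)` has a real eigenvalue STRICTLY
inside the spread window `(−max(t₀,t₁), −min(t₀,t₁))` (counted with algebraic multiplicity as a root of the
characteristic polynomial).  Intermediate value theorem on the real polynomial `t ↦ det D_W(U,t,1)`
between the two masses (barrier lemma `exists_zero_between_of_det_mul_neg`); the masses are automatically distinct,
a degenerate pair having weight `det² ≥ 0`. -/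
theorem one_le_countP_window_of_re_mul_neg (U : GaugeConfig 4 N (Matrix.specialUnitaryGroup (Fin 3) ℂ)) (t₀ t₁ : ℝ)
    (hneg : (fermionDet (wilsonDirac (fundamentalRep (Fin 3)) U t₀ 1) *
      fermionDet (wilsonDirac (fundamentalRep (Fin 3)) U t₁ 1)).re < 0) :
    1 ≤ (wilsonDirac (fundamentalRep (Fin 3)) U 0 1).charpoly.roots.countP
      fun z => z.im = 0 ∧ -max t₀ t₁ < z.re ∧ z.re < -min t₀ t₁ := by
  classical
  set D₀ := wilsonDirac (fundamentalRep (Fin 3)) U 0 1 with hD₀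
  have hΓ := Literature.Barriers.QuantumFields.isGammaHermitian_wilsonDirac (L := N)
    (fundamentalRep (Fin 3)) (fun g => fundamentalRep_mem_unitaryGroup g) U 0 1
  -- the two masses, ordered
  set a := min t₀ t₁ with ha
  set b := max t₀ t₁ with hb
  have hprod : (fermionDet (wilsonDirac (fundamentalRep (Fin 3)) U a 1) *
      fermionDet (wilsonDirac (fundamentalRep (Fin 3)) U b 1)).re < 0 := by
    rcases le_total t₀ t₁ with h | h
    · rw [ha, hb, min_eq_left h, max_eq_right h]; exact hneg
    · rw [ha, hb, min_eq_right h, max_eq_left h, mul_comm]; exact hneg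
  have hab : a < b := by
    rcases lt_or_eq_of_le (min_le_max : a ≤ b) with h | h
    · exact h
    · exfalso
      have him : (fermionDet (wilsonDirac (fundamentalRep (Fin 3)) U b 1)).im = 0 :=
        fermionDet_wilsonDirac_im_holds (fundamentalRep (Fin 3)) (fun g => fundamentalRep_mem_unitaryGroup g) U b 1
      rw [← ha, ← hb] at h
      rw [h, Complex.mul_re, him, mul_zero, sub_zero] at hprod
      exact absurd hprod (not_lt.2 (mul_self_nonneg _))
  -- rewrite the determinants around `D₀`: `D_W(t) = D₀ + t·1`
  have hadd : ∀ t : ℝ, wilsonDirac (fundamentalRep (Fin 3)) U t 1 = D₀ + (t : ℂ) • (1 : Matrix _ _ ℂ) := by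
    intro t
    have := Literature.Barriers.QuantumFields.wilsonDirac_add_mass (fundamentalRep (Fin 3)) U 0 t 1
    rw [zero_add] at this
    exact this
  have hprod' : ((D₀ + ((a : ℝ) : ℂ) • (1 : Matrix _ _ ℂ)).det *
      (D₀ + ((b : ℝ) : ℂ) • (1 : Matrix _ _ ℂ)).det).re < 0 := by
    have := hprod
    simp only [fermionDet] at this
    rwa [hadd a, hadd b] at this
  obtain ⟨τ, hτ, hdet⟩ := hΓ.exists_zero_between_of_det_mul_neg hab hprod'
  -- `-τ` is a real root of `charpoly D₀` inside the window
  have hroot : (-(τ : ℂ)) ∈ D₀.charpoly.roots := by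
    rw [Polynomial.mem_roots (Matrix.charpoly_monic D₀).ne_zero, Polynomial.IsRoot.def, Matrix.eval_charpoly]
    have h1 : Matrix.scalar (TorusSite 4 N × Fin 3 × Fin 4) (-(τ : ℂ)) - D₀ =
        -(D₀ + (τ : ℂ) • (1 : Matrix _ _ ℂ)) := by
      rw [Matrix.scalar_apply, ← Matrix.smul_one_eq_diagonal, neg_smul]
      abel
    rw [h1, Matrix.det_neg, hdet, mul_zero]
  refine Multiset.countP_pos.2 ⟨-(τ : ℂ), hroot, by simp, ?_, ?_⟩
  · simp only [Complex.neg_re, Complex.ofReal_re, neg_lt_neg_iff]; exact hτ.2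
  · simp only [Complex.neg_re, Complex.ofReal_re, neg_lt_neg_iff]; exact hτ.1

/-- **Pointwise bound (two flavours).**  For every gauge field and `t : Fin 2 → ℝ`, with
`P = det D_W(t₀)·det D_W(t₁)` and `W` the number of real eigenvalues of `D_W(U,0,1)` in the open spread window
`(−max(t₀,t₁), −min(t₀,t₁))`:  `∏_f |det D_W(t_f)| − Re P ≤ 2·W·∏_f |det D_W(t_f)|`.  If `Re P ≥ 0` the left side
vanishes (`P` is real); otherwise `W ≥ 1` and `−Re P ≤ |P|`. -/
theorem norm_sub_re_le_two_mul_windowCount_mul_norm (U : GaugeConfig 4 N (Matrix.specialUnitaryGroup (Fin 3) ℂ)) (t : Fin 2 → ℝ) :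
    (∏ f : Fin 2, ‖fermionDet (wilsonDirac (fundamentalRep (Fin 3)) U (t f) 1)‖) -
        (∏ f : Fin 2, fermionDet (wilsonDirac (fundamentalRep (Fin 3)) U (t f) 1)).re ≤
      2 * (((wilsonDirac (fundamentalRep (Fin 3)) U 0 1).charpoly.roots.countP
          (fun z : ℂ => z.im = 0 ∧ -max (t 0) (t 1) < z.re ∧ z.re < -min (t 0) (t 1)) : ℝ) *
        ∏ f : Fin 2, ‖fermionDet (wilsonDirac (fundamentalRep (Fin 3)) U (t f) 1)‖) := by
  classical
  set det : Fin 2 → ℂ := fun f => fermionDet (wilsonDirac (fundamentalRep (Fin 3)) U (t f) 1) with hdet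
  have him : ∀ f, (det f).im = 0 := fun f =>
    fermionDet_wilsonDirac_im_holds (fundamentalRep (Fin 3)) (fun g => fundamentalRep_mem_unitaryGroup g) U (t f) 1
  have hPim : (∏ f, det f).im = 0 := by
    rw [Fin.prod_univ_two, Complex.mul_im, him 0, him 1]; ring
  have hA0 : 0 ≤ ∏ f, ‖det f‖ := Finset.prod_nonneg fun f _ => norm_nonneg _
  have hW0 : (0 : ℝ) ≤ ((wilsonDirac (fundamentalRep (Fin 3)) U 0 1).charpoly.roots.countP
      (fun z : ℂ => z.im = 0 ∧ -max (t 0) (t 1) < z.re ∧ z.re < -min (t 0) (t 1)) : ℝ) := Nat.cast_nonneg _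
  have hnormP : ‖∏ f, det f‖ = ∏ f, ‖det f‖ := norm_prod _ _
  by_cases h : (∏ f, det f).re < 0
  · -- a negative weight: at least one window mode, and `|P| − Re P ≤ 2|P|`
    have h2 : (det 0 * det 1).re < 0 := by rwa [Fin.prod_univ_two] at h
    have hW1 : (1 : ℝ) ≤ ((wilsonDirac (fundamentalRep (Fin 3)) U 0 1).charpoly.roots.countP
        (fun z : ℂ => z.im = 0 ∧ -max (t 0) (t 1) < z.re ∧ z.re < -min (t 0) (t 1)) : ℝ) := by
      exact_mod_cast one_le_countP_window_of_re_mul_neg U (t 0) (t 1) h2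
    have hre : -(∏ f, det f).re ≤ ∏ f, ‖det f‖ := by
      rw [← hnormP]
      exact (neg_le_abs _).trans (Complex.abs_re_le_norm _)
    nlinarith [hre, hA0, hW1]
  · -- non-negative weight: `Re P = |P| = ∏ |det|`
    push Not at h
    have hP : (∏ f, det f).re = ∏ f, ‖det f‖ := by
      rw [← hnormP, ← Complex.abs_re_eq_norm.2 hPim, abs_of_nonneg h]
    rw [hP, sub_self]
    exact mul_nonneg zero_le_two (mul_nonneg hW0 hA0)

/-! ### §3 The integrated deficit bound for two flavours -/

/-- **Positivity deficit ≤ expected window count (two flavours).**  For every torus side, coupling and bare pair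
`t`, `(1 − ⟨sign⟩₊)/2 ≤ E₊[#{real eigenvalues of D_W(U,0,1) in (−max t, −min t)}]`, both sides as quotients of
Wilson-measure integrals with the phase-quenched weight `∏_f |det D_W(U,t_f,1)|`.  (Integrate §2; the window count
is measurable by §1 and bounded by `12 N⁴`; `Z₊ > 0`.)  The two-flavour sharpening of the landed
`PositivityDeficitLeDefects`, which charges every deep crosser of every flavour. -/
theorem positivityDeficit_le_windowCount_two (β : ℝ) (t : Fin 2 → ℝ) :
    (1 - (∫ U, (∏ f : Fin 2, fermionDet (wilsonDirac (fundamentalRep (Fin 3)) U (t f) 1)).re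
        ∂(wilsonMeasure (d := 4) (L := N) (fundamentalRep (Fin 3)) β)) /
      (∫ U, ∏ f : Fin 2, ‖fermionDet (wilsonDirac (fundamentalRep (Fin 3)) U (t f) 1)‖
        ∂(wilsonMeasure (d := 4) (L := N) (fundamentalRep (Fin 3)) β))) / 2 ≤
    (∫ U, ((wilsonDirac (fundamentalRep (Fin 3)) U 0 1).charpoly.roots.countP
          (fun z : ℂ => z.im = 0 ∧ -max (t 0) (t 1) < z.re ∧ z.re < -min (t 0) (t 1)) : ℝ) *
        ∏ f : Fin 2, ‖fermionDet (wilsonDirac (fundamentalRep (Fin 3)) U (t f) 1)‖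
        ∂(wilsonMeasure (d := 4) (L := N) (fundamentalRep (Fin 3)) β)) /
      (∫ U, ∏ f : Fin 2, ‖fermionDet (wilsonDirac (fundamentalRep (Fin 3)) U (t f) 1)‖
        ∂(wilsonMeasure (d := 4) (L := N) (fundamentalRep (Fin 3)) β)) := by
  classical
  set μ := wilsonMeasure (d := 4) (L := N) (fundamentalRep (Fin 3)) β with hμ
  set A : GaugeConfig 4 N (Matrix.specialUnitaryGroup (Fin 3) ℂ) → ℝ := fun U =>
    ∏ f : Fin 2, ‖fermionDet (wilsonDirac (fundamentalRep (Fin 3)) U (t f) 1)‖ with hA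
  set R : GaugeConfig 4 N (Matrix.specialUnitaryGroup (Fin 3) ℂ) → ℝ := fun U =>
    (∏ f : Fin 2, fermionDet (wilsonDirac (fundamentalRep (Fin 3)) U (t f) 1)).re with hR
  set W : GaugeConfig 4 N (Matrix.specialUnitaryGroup (Fin 3) ℂ) → ℝ := fun U =>
    (((wilsonDirac (fundamentalRep (Fin 3)) U 0 1).charpoly.roots.countP
      (fun z : ℂ => z.im = 0 ∧ -max (t 0) (t 1) < z.re ∧ z.re < -min (t 0) (t 1)) : ℝ)) with hW
  change (1 - (∫ U, R U ∂μ) / (∫ U, A U ∂μ)) / 2 ≤ (∫ U, W U * A U ∂μ) / (∫ U, A U ∂μ)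
  have hAeq : A = fun U => ‖(diracMatrix U t).det‖ := funext fun U => (norm_det_diracMatrix U t).symm
  have hReq : R = fun U => ((diracMatrix U t).det).re := funext fun U => by
    simp only [hR, det_diracMatrix]
  -- positivity of the normalisation
  have hZ : 0 < ∫ U, A U ∂μ := by
    rw [hAeq]; exact integral_norm_det_diracMatrix_pos_all β t
  -- integrability
  have hAi : Integrable A μ := by rw [hAeq]; exact integrable_norm_det_diracMatrix t μ
  have hA0 : ∀ U, 0 ≤ A U := fun U => Finset.prod_nonneg fun f _ => norm_nonneg _
  have hRi : Integrable R μ := by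
    refine hAi.mono' ?_ (Eventually.of_forall fun U => ?_)
    · rw [hReq]
      exact (Complex.continuous_re.comp (continuous_det_diracMatrix t)).aestronglyMeasurable
    · rw [hReq, hAeq, Real.norm_eq_abs]
      exact Complex.abs_re_le_norm _
  have hWm : Measurable W :=
    (measurable_from_nat (f := (Nat.cast : ℕ → ℝ))).comp
      (measurable_countP_charpoly_roots_window
        (continuous_wilsonDirac (fundamentalRep (Fin 3)) (continuous_fundamentalRep (Fin 3)) 0 1) _ _)
  have hW0 : ∀ U, 0 ≤ W U := fun U => Nat.cast_nonneg _
  have hWle : ∀ U, W U ≤ Fintype.card (TorusSite 4 N × Fin 3 × Fin 4) := by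
    intro U
    have h1 := Multiset.countP_le_card
      (fun z : ℂ => z.im = 0 ∧ -max (t 0) (t 1) < z.re ∧ z.re < -min (t 0) (t 1))
      (wilsonDirac (fundamentalRep (Fin 3)) U 0 1).charpoly.roots
    have h2 := Polynomial.card_roots' (wilsonDirac (fundamentalRep (Fin 3)) U 0 1).charpoly
    rw [Matrix.charpoly_natDegree_eq_dim] at h2
    simp only [hW]
    exact_mod_cast h1.trans h2
  have hWAi : Integrable (fun U => W U * A U) μ := by
    refine (hAi.const_mul (Fintype.card (TorusSite 4 N × Fin 3 × Fin 4))).mono'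
      (hWm.aestronglyMeasurable.mul hAi.aestronglyMeasurable) (Eventually.of_forall fun U => ?_)
    rw [Real.norm_eq_abs, abs_of_nonneg (mul_nonneg (hW0 U) (hA0 U))]
    exact mul_le_mul_of_nonneg_right (hWle U) (hA0 U)
  -- integrate the pointwise bound
  have hpt : ∀ U, A U - R U ≤ 2 * (W U * A U) := fun U => by
    have := norm_sub_re_le_two_mul_windowCount_mul_norm U t
    simp only [hA, hR, hW]
    linarith
  have hint : (∫ U, A U ∂μ) - ∫ U, R U ∂μ ≤ 2 * ∫ U, W U * A U ∂μ := by
    rw [← integral_sub hAi hRi, ← integral_const_mul]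
    exact integral_mono (hAi.sub hRi) (hWAi.const_mul 2) hpt
  -- divide by `Z₊ > 0`
  rw [le_div_iff₀ hZ]
  have key : (1 - (∫ U, R U ∂μ) / ∫ U, A U ∂μ) / 2 * ∫ U, A U ∂μ = ((∫ U, A U ∂μ) - ∫ U, R U ∂μ) / 2 := by
    field_simp
  rw [key]
  linarith

/-! ### §4 Sign coherence from a small expected window count -/

/-- **Window ⇒ sign (two flavours).**  If the phase-quenched expected number of real eigenvalues of `D_W(U,0,1)`
in the spread window `(−max t, −min t)` is `≤ 1/4`, then `½ ≤ |∫ det diracMatrix dμ_W| / ∫ |det diracMatrix| dμ_W`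
(`(1 − ⟨sign⟩₊)/2 ≤ 1/4` by §3, and `⟨sign⟩₊ = ∫ Re det / ∫ |det| ≤ |∫ det| / ∫ |det|`). -/
theorem sign_of_window_two (β : ℝ) (t : Fin 2 → ℝ)
    (h : (∫ U : GaugeConfig 4 N (Matrix.specialUnitaryGroup (Fin 3) ℂ),
        ((wilsonDirac (fundamentalRep (Fin 3)) U 0 1).charpoly.roots.countP
            (fun z : ℂ => z.im = 0 ∧ -max (t 0) (t 1) < z.re ∧ z.re < -min (t 0) (t 1)) : ℝ) *
          ∏ f : Fin 2, ‖fermionDet (wilsonDirac (fundamentalRep (Fin 3)) U (t f) 1)‖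
        ∂(wilsonMeasure (d := 4) (L := N) (fundamentalRep (Fin 3)) β)) /
      (∫ U : GaugeConfig 4 N (Matrix.specialUnitaryGroup (Fin 3) ℂ),
        ∏ f : Fin 2, ‖fermionDet (wilsonDirac (fundamentalRep (Fin 3)) U (t f) 1)‖
        ∂(wilsonMeasure (d := 4) (L := N) (fundamentalRep (Fin 3)) β)) ≤ 1 / 4) :
    (1 / 2 : ℝ) ≤
      ‖∫ U : GaugeConfig 4 N (Matrix.specialUnitaryGroup (Fin 3) ℂ), (diracMatrix U t).det ∂(wilsonMeasure (fundamentalRep (Fin 3)) β)‖ /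
        (∫ U : GaugeConfig 4 N (Matrix.specialUnitaryGroup (Fin 3) ℂ), ‖(diracMatrix U t).det‖ ∂(wilsonMeasure (fundamentalRep (Fin 3)) β)) := by
  set μW := wilsonMeasure (d := 4) (L := N) (fundamentalRep (Fin 3)) β with hμW
  have hP := positivityDeficit_le_windowCount_two (N := N) β t
  have hZeq : (∫ U, ∏ f : Fin 2, ‖fermionDet (wilsonDirac (fundamentalRep (Fin 3)) U (t f) 1)‖ ∂μW) =
      ∫ U, ‖(diracMatrix U t).det‖ ∂μW :=
    integral_congr_ae (Eventually.of_forall fun U => (norm_det_diracMatrix U t).symm)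
  have hZ : 0 < ∫ U, ‖(diracMatrix U t).det‖ ∂μW := integral_norm_det_diracMatrix_pos_all β t
  have hdetInt : Integrable (fun U : GaugeConfig 4 N (Matrix.specialUnitaryGroup (Fin 3) ℂ) => (diracMatrix U t).det) μW :=
    (integrable_norm_det_diracMatrix t μW).mono' (continuous_det_diracMatrix t).aestronglyMeasurable
      (Eventually.of_forall fun U => le_rfl)
  have hReq : (∫ U, (∏ f : Fin 2, fermionDet (wilsonDirac (fundamentalRep (Fin 3)) U (t f) 1)).re ∂μW) =
      (∫ U, (diracMatrix U t).det ∂μW).re := by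
    have h1 : (∫ U, (∏ f : Fin 2, fermionDet (wilsonDirac (fundamentalRep (Fin 3)) U (t f) 1)).re ∂μW) =
        ∫ U, ((diracMatrix U t).det).re ∂μW :=
      integral_congr_ae (Eventually.of_forall fun U => by simp only [det_diracMatrix])
    rw [h1]
    have h2 := integral_re hdetInt
    simpa using h2
  have hRle : (∫ U, (∏ f : Fin 2, fermionDet (wilsonDirac (fundamentalRep (Fin 3)) U (t f) 1)).re ∂μW) ≤
      ‖∫ U, (diracMatrix U t).det ∂μW‖ := by
    rw [hReq]; exact Complex.re_le_norm _
  have hAZ : (1 / 2 : ℝ) ≤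
      (∫ U, (∏ f : Fin 2, fermionDet (wilsonDirac (fundamentalRep (Fin 3)) U (t f) 1)).re ∂μW) /
        (∫ U, ∏ f : Fin 2, ‖fermionDet (wilsonDirac (fundamentalRep (Fin 3)) U (t f) 1)‖ ∂μW) := by
    linarith [hP.trans h]
  rw [hZeq] at hAZ
  exact hAZ.trans (div_le_div_of_nonneg_right hRle hZ.le)

/-! ### §5 The window law along a free datum, its glue, and the composition of the reshaped line -/

/-- **`WindowAt`-glue**: along an admissible two-flavour datum `d`, if on some admissible volume sequence
`L ≥ L⁰` the phase-quenched expected number of real modes of `D_W(U,0,1)` in the spread window of every window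
pair is `≤ 1/4` for every large `δ`, every `M > 0`, eventually in `k` (the statement of the registered stub
`stub_windowAt`, unfolded), then the sign law `SignAt d` holds (§4 pair by pair). -/
theorem signAt_of_windowAt {d : LineData 2}
    (h : ∃ L : ℕ → ℕ, Tendsto (fun k => d.a k * (L k : ℝ)) atTop atTop ∧ (∀ᶠ k in atTop, d.vfloor k ≤ L k) ∧
      ∀ᶠ δ in atTop, ∀ M : ℝ, 0 < M → ∀ᶠ k in atTop,
        (floorSetD d δ k).Nonempty → -1 < thrD d δ k → ∀ t : Fin 2 → ℝ,
          (∀ f, thrD d δ k < t f) → (∀ f, t f ≤ thrD d δ k + d.a k * M / d.zm k) →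
            (∫ U : GaugeConfig 4 (2 * L k + 1) (Matrix.specialUnitaryGroup (Fin 3) ℂ),
                ((wilsonDirac (fundamentalRep (Fin 3)) U 0 1).charpoly.roots.countP
                    (fun z : ℂ => z.im = 0 ∧ -max (t 0) (t 1) < z.re ∧ z.re < -min (t 0) (t 1)) : ℝ) *
                  ∏ f : Fin 2, ‖fermionDet (wilsonDirac (fundamentalRep (Fin 3)) U (t f) 1)‖
                ∂(wilsonMeasure (d := 4) (L := 2 * L k + 1) (fundamentalRep (Fin 3)) (d.β k))) /
              (∫ U : GaugeConfig 4 (2 * L k + 1) (Matrix.specialUnitaryGroup (Fin 3) ℂ),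
                ∏ f : Fin 2, ‖fermionDet (wilsonDirac (fundamentalRep (Fin 3)) U (t f) 1)‖
                ∂(wilsonMeasure (d := 4) (L := 2 * L k + 1) (fundamentalRep (Fin 3)) (d.β k))) ≤ 1 / 4) :
    SignAt d := by
  obtain ⟨L, hL, hfl, hδ⟩ := h
  refine ⟨L, hL, hfl, hδ.mono fun δ hd M hM => (hd M hM).mono fun k hk hne hthr t ht₁ ht₂ => ?_⟩
  exact sign_of_window_two (d.β k) t (hk hne hthr t ht₁ ht₂)

/-- **The crux from the four laws of the reshaped line** (skeleton v5: `stub_lightFree`, `stub_lowerAt`,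
`stub_windowAt` for `N_f = 2`, `stub_extinctAt` for `N_f = 3`): pack the datum of the free light moment and run the
threshold line along it (`compositionD`), feeding the sign law from the WINDOW law at `N_f = 2` (`signAt_of_windowAt`)
and from the deep-crosser extinction law at `N_f = 3` (`signAt_of_extinctAt`). -/
theorem MobilityGap_of_freeLaws_window :
    LawLightFree → LawLowerFree →
    (∀ d : LineData 2, LightMomentAt 2 d.a d.β d.s →
      ∃ L : ℕ → ℕ, Tendsto (fun k => d.a k * (L k : ℝ)) atTop atTop ∧ (∀ᶠ k in atTop, d.vfloor k ≤ L k) ∧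
        ∀ᶠ δ in atTop, ∀ M : ℝ, 0 < M → ∀ᶠ k in atTop,
          (floorSetD d δ k).Nonempty → -1 < thrD d δ k → ∀ t : Fin 2 → ℝ,
            (∀ f, thrD d δ k < t f) → (∀ f, t f ≤ thrD d δ k + d.a k * M / d.zm k) →
              (∫ U : GaugeConfig 4 (2 * L k + 1) (Matrix.specialUnitaryGroup (Fin 3) ℂ),
                  ((wilsonDirac (fundamentalRep (Fin 3)) U 0 1).charpoly.roots.countP
                      (fun z : ℂ => z.im = 0 ∧ -max (t 0) (t 1) < z.re ∧ z.re < -min (t 0) (t 1)) : ℝ) *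
                    ∏ f : Fin 2, ‖fermionDet (wilsonDirac (fundamentalRep (Fin 3)) U (t f) 1)‖
                  ∂(wilsonMeasure (d := 4) (L := 2 * L k + 1) (fundamentalRep (Fin 3)) (d.β k))) /
                (∫ U : GaugeConfig 4 (2 * L k + 1) (Matrix.specialUnitaryGroup (Fin 3) ℂ),
                  ∏ f : Fin 2, ‖fermionDet (wilsonDirac (fundamentalRep (Fin 3)) U (t f) 1)‖
                  ∂(wilsonMeasure (d := 4) (L := 2 * L k + 1) (fundamentalRep (Fin 3)) (d.β k))) ≤ 1 / 4) →
    (∀ d : LineData 3, LightMomentAt 3 d.a d.β d.s → ExtinctAt d) →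
    Summit.QuantumFields.QCD.Theses.WilsonMobilityGap.MobilityGap := by
  intro h₁ h₂ h₃ h₄ Nf hNf
  rcases hNf with rfl | rfl
  · obtain ⟨d, hd⟩ := exists_lineData_of_lightMomentFree (h₁ 2 (Or.inl rfl))
    exact compositionD d (badFloorAt_of_lightMomentAt hd) (h₂ 2 (Or.inl rfl) d hd) (signAt_of_windowAt (h₃ d hd))
  · obtain ⟨d, hd⟩ := exists_lineData_of_lightMomentFree (h₁ 3 (Or.inr rfl))
    exact compositionD d (badFloorAt_of_lightMomentAt hd) (h₂ 3 (Or.inr rfl) d hd) (signAt_of_extinctAt (h₄ d hd))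

end Summit.QuantumFields.QCD.Theorems.MobilityGapSketch

end
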